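import Summits.AtomisticToContinuum.BoseEinsteinCondensation.Theses.BECCutLineWeakDisorder
import Literature.MathematicalPhysics.QuantumManyBody.GroundState
import Literature.MathematicalPhysics.QuantumManyBody.BoseGasSymmetrisedProduct
import Literature.MathematicalPhysics.QuantumManyBody.BoseGasThermodynamicLimitRuelle
import Literature.MathematicalPhysics.QuantumManyBody.JelliumBoseGasProofs
import HarnessLib

/-!
# Disproof work file for crux `GroundStateRigidity` (stmt-AtomisticToContinuum-9072) — findings

(cdisprove seat `refuter-cdisprove-stmt-AtomisticToContinuum-9072-0`, cycle 1, 2026-08-16; crux decl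
`Summit.AtomisticToContinuum.BoseEinsteinCondensation.Theses.BECCutLineWeakDisorder.GroundStateRigidity`,
shared verbatim by 8 routes.)  Everything below is kernel-checked unless marked `sorry` (near-misses only).

## Verdict so far: NO KILL of the crux; it resists for a structural reason

`GroundStateRigidity` at a box `(v, N, L)` (`RigidAt v N L` below) is equivalent to: `E₀(N,L) < ⊤` and the
bottom of the Bose-sector Dirichlet spectrum of `H_N` on the finite-energy region is SIMPLE (compact
resolvent is automatic on the bounded box, so simplicity = gap = convergence of near-minimisers mod phase).
* bounded measurable `v`: true classically (positivity-improving `e^{-tH}`, Reed–Simon IV XIII.44–47) — this is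
  exactly stubs 0–4 of line `Sketch`; nothing to attack.
* unbounded admissible `v` (hard cores `⊤·1_{[0,a]}`, hollow shells `⊤·1_{[R₁,R₂]}`, and — NOTE — also FINITE
  `v` with a non-integrable wall such as `(r - r₁)⁻²·1_{|r-r₁|<s}`, which forces `Ψ = 0` on the shell
  `|xᵢ - xⱼ| = r₁` by the divergence of `∫ dt/t²`, so "finite-valued ⇒ positivity improving" is FALSE; the
  honest dividing line is `v ∈ L¹_loc((0,∞), r²dr)` vs not): the finite-energy region
  `Ω_N = {X ∈ Λ^N : |xᵢ-xⱼ| ∉ K_v}` (`K_v` = essential support of `{v = ⊤}` ∪ non-integrable walls) may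
  disconnect; rigidity ⇔ a UNIQUE energy-minimising component of `Ω_N / S_N`, invariant under the cube group.
* Why no substantive counterexample is expected: a non-principal component either binds a cluster inside a
  shell (relative coordinate confined to radius `≤ R₀`: kinetic cost `≥ 2π²/R₀²` per bond, FIXED in `N, ρ`)
  or cages hard spheres against the walls (cost `≥ c/slack²`); the principal (dilute) component costs
  `E₀(N) - E₀(N-k) ≤ k·C(v)(ρ + L⁻²)` per removed particle (insertion window).  At `ρ < ρ₀(v)` the dilute
  component wins by a margin bounded below uniformly in `N` — so a counterexample would need a caged/bound
  component whose excess energy is `O(ρ)` per particle, and I found no mechanism for that (searched: sparse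
  locally-jammed packings Kahle2012/Böröczky are measure-zero contact configurations, not open components;
  open cages need all six walls and pay `1/slack²`).  State of knowledge on the PREMISE of the why-might-fail:
  disconnection of the hard-sphere configuration space at arbitrarily low density DOES occur for suitable `(N, L)`
  — strictly jammed "Dionysian" packings with density → 0 (Dennis–Corwin, PRL 128 (2022) 018002, periodic
  cell; Physics 15, s1 (2022) synopsis "Stable hard-sphere packings with arbitrarily low density"; Kahle 2012 for
  locally jammed disks in a square; cites from a degraded search, to be verified): shrinking the diameter by `ε`
  turns each into an open pocket disconnected from the fluid, i.e. a non-principal component — but with slack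
  `O(ε)`, hence Dirichlet energy `≳ ε⁻²`, never a tie with the fluid.  So the crux is "true but its unbounded
  half is unproved", consistent with every route's why-might-fail; a refutation would need a NEW kind of
  component (loose yet caged), for which §4's `N = 2` small box is the only regime found (there `L < 1/√2`,
  far from the thermodynamic boxes `L = (N/ρ)^{1/3} → ∞`).

## Index of results (all `theorem`s sorry-free unless flagged)

§0 `RigidAt`, `groundStateRigidity_iff` (definitional), `sideLength_pos`, `sideLength_pow_three`.
§1 MECHANISM LEMMA `not_rigidAt_of_disjoint`: two disjointly supported `δ`-near-minimisers at every `δ`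
   ⇒ `¬ RigidAt` (their `L²` distance is `2` for every phase, `lintegral_sub_mul_sq_eq_two`);
   `exists_disjoint_trialStates` (`N ≥ 1`, `L > 0`); `not_rigidAt_of_groundStateEnergy_eq_top`
   (**`E₀ = ⊤` kills rigidity** — the statement is NOT vacuously true there, it is false there; so every
   proof must show hard cores fit: `E₀ < ⊤` eventually at `ρ < ρ₀`).
§2 LOAD-BEARING: finite range.  `groundStateRigidity_false_without_finiteRange` : `¬` (crux with only
   `Measurable v`) — witness `v ≡ ⊤` (`interaction_top_eq_top`, `E₀ = ⊤` for `N ≥ 2`).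
§3 LOAD-BEARING: low density.  `groundStateRigidity_false_at_all_densities` : `¬` (crux with `∀ ρ > 0`)
   — witness unit hard spheres `hardSphere` at `ρ = 64`: pigeonhole `exists_dist_le_one` in cells of side
   `1/2` gives `E₀(N, (N/64)^{1/3}) = ⊤` for all `N ≥ 64` (`ceil_cube_lt`, `groundStateEnergy_hardSphere_eq_top`).
§4 SMALL-MODEL DEGENERACY (PROVED, `SmallModel.not_rigidAt_two_hardSpheres`, `…_example` at L = 13/20,
   `SmallModel.groundStateRigidity_finiteEnergy_strengthening_false`): two unit hard spheres in `Λ_L`, `1/√3 < L < 1/√2`: `E₀ < ⊤` but the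
   free region `{|x₁-x₂| > 1}` splits into 8 octant pieces of `x₁ - x₂` (4 classes mod `S₂`), permuted by
   the cube's reflections ⇒ 4-fold degenerate Bose ground state ⇒ `¬ RigidAt hardSphere 2 L`.  This is the
   hard-core mechanism of every why-might-fail, checked in its smallest instance; it refutes the natural
   strengthening "admissible `v`, `E₀(N,L) < ⊤` ⇒ `RigidAt v N L`" and shows `stub_uniqueUnbounded` must use
   `ρ < ρ₀` and `N` large, not just `E₀ < ⊤`.
§5 Line `Sketch` (lead skeleton v1, 6 stubs): no stub found false; per-stub notes at the end of the file.

Landed / proposed: p100047 ACCEPTED = `Theorems/GroundStateRigidity/Negative/LoadBearingHypotheses.lean`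
(§1–§3: `not_rigid_of_groundStateEnergy_eq_top`, `groundStateRigidity_false_without_finiteRange`,
`groundStateRigidity_false_at_all_densities`).  §4 as four landable files (`Negative/BoxReflection.lean` →
`TwoHardSpheresSupport.lean` → `TwoHardSpheresLocalisation.lean` → `TwoHardSpheres.lean`, each ≤ 334 lines,
rc 0) is attached as item EVIDENCE (`TwoHardSpheresMono.lean`, `A_…`–`D_…`, `NEGATIVE-FILES.md`): their
proposals bounced `perm.theorems-prover-only` only because the resumed seat's identity is derived as `operator`;
any prover/lead (or a re-leased refuter seat) can land them verbatim with `--kind proof --supports`.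
-/

noncomputable section

namespace Summit.AtomisticToContinuum.BoseEinsteinCondensation.Cruxes.GroundStateRigidity.Disproof

open Literature.MathematicalPhysics.QuantumManyBody.BoseGas
open Summit.AtomisticToContinuum.BoseEinsteinCondensation.Theses.BECCutLineWeakDisorder
open MeasureTheory Filter Metric
open scoped ENNReal NNReal Topology

/-! ## 0. The local form of the crux -/

/-- **Rigidity of near-minimisers at `(v, N, L)`** — the conclusion of the crux at one box: for every
`η > 0` some `δ > 0` makes any two `δ`-near-minimisers of the Dirichlet energy `η`-close in `L²` up
to a constant phase. [folklore] -/
def RigidAt (v : ℝ → ℝ≥0∞) (N : ℕ) (L : ℝ) : Prop :=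
  ∀ η : ℝ, 0 < η → ∃ δ : ℝ≥0∞, 0 < δ ∧ ∀ Ψ Φ : TrialState N L,
    energy v Ψ ≤ groundStateEnergy v N L + δ → energy v Φ ≤ groundStateEnergy v N L + δ →
    ∃ c : ℂ, ‖c‖ = 1 ∧ ∫⁻ X, (‖Ψ.ψ X - c * Φ.ψ X‖₊ : ℝ≥0∞) ^ 2 ≤ ENNReal.ofReal η

/-- The crux, by name, is eventual rigidity along the thermodynamic sequence of boxes at every small
density (definitional unfolding; fixes the reading used below). [folklore] -/
theorem groundStateRigidity_iff :
    GroundStateRigidity ↔ ∀ v : ℝ → ℝ≥0∞, IsRepulsiveFiniteRange v → ∃ ρ₀ : ℝ, 0 < ρ₀ ∧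
      ∀ ρ : ℝ, 0 < ρ → ρ < ρ₀ → ∀ᶠ N : ℕ in atTop, RigidAt v N (sideLength ρ N) :=
  Iff.rfl

/-- The box side `(N/ρ)^{1/3}` is positive for `ρ > 0`, `N ≥ 1`. [folklore] -/
theorem sideLength_pos {ρ : ℝ} (hρ : 0 < ρ) {N : ℕ} (hN : 0 < N) : 0 < sideLength ρ N := by
  unfold sideLength
  exact Real.rpow_pos_of_pos (div_pos (by exact_mod_cast hN) hρ) _

/-- `L³ = N/ρ` for the thermodynamic box. [folklore] -/
theorem sideLength_pow_three {ρ : ℝ} (hρ : 0 < ρ) {N : ℕ} (hN : 0 < N) :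
    sideLength ρ N ^ 3 = N / ρ := by
  have h := div_sideLength_pow_three hρ hN
  have hL : 0 < sideLength ρ N := sideLength_pos hρ hN
  field_simp at h
  field_simp
  linarith

/-! ## 1. Disjointly supported pairs of trial states defeat rigidity -/

/-- Two disjointly supported normalised states are at squared `L²`-distance `2` from each other,
whatever the relative phase. [folklore] -/
theorem lintegral_sub_mul_sq_eq_two {N : ℕ} {L : ℝ} (Ψ Φ : TrialState N L)
    (h : ∀ X, Ψ.ψ X = 0 ∨ Φ.ψ X = 0) {c : ℂ} (hc : ‖c‖ = 1) :
    ∫⁻ X, (‖Ψ.ψ X - c * Φ.ψ X‖₊ : ℝ≥0∞) ^ 2 = 2 := by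
  have hpt : ∀ X, (‖Ψ.ψ X - c * Φ.ψ X‖₊ : ℝ≥0∞) ^ 2 =
      (‖Ψ.ψ X‖₊ : ℝ≥0∞) ^ 2 + (‖Φ.ψ X‖₊ : ℝ≥0∞) ^ 2 := by
    intro X
    rcases h X with h0 | h0
    · rw [h0, zero_sub, nnnorm_neg, nnnorm_mul, ENNReal.coe_mul,
        coe_nnnorm_eq_one_of_norm_eq_one hc, one_mul]
      simp
    · rw [h0, mul_zero, sub_zero]
      simp
  simp_rw [hpt]
  have hm : Measurable fun X => (‖Ψ.ψ X‖₊ : ℝ≥0∞) ^ 2 :=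
    (Ψ.contDiff.continuous.measurable.nnnorm.coe_nnreal_ennreal).pow_const 2
  rw [lintegral_add_left hm, Ψ.norm_eq, Φ.norm_eq]
  norm_num

/-- **No rigidity from disjoint near-minimisers.** If at every slack `δ > 0` there are two
`δ`-near-minimisers with disjoint supports, rigidity fails at `(v, N, L)` (take `η = 1`: their
distance is `2 > 1` for every phase). [folklore] -/
theorem not_rigidAt_of_disjoint {v : ℝ → ℝ≥0∞} {N : ℕ} {L : ℝ}
    (h : ∀ δ : ℝ≥0∞, 0 < δ → ∃ Ψ Φ : TrialState N L, (∀ X, Ψ.ψ X = 0 ∨ Φ.ψ X = 0) ∧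
      energy v Ψ ≤ groundStateEnergy v N L + δ ∧ energy v Φ ≤ groundStateEnergy v N L + δ) :
    ¬ RigidAt v N L := by
  intro hR
  obtain ⟨δ, hδ, hΨΦ⟩ := hR 1 one_pos
  obtain ⟨Ψ, Φ, hdisj, hΨ, hΦ⟩ := h δ hδ
  obtain ⟨c, hc, hle⟩ := hΨΦ Ψ Φ hΨ hΦ
  rw [lintegral_sub_mul_sq_eq_two Ψ Φ hdisj hc, ENNReal.ofReal_one] at hle
  exact absurd hle (by norm_num)

/-- **Two disjointly supported trial states exist** in every box (`N ≥ 1`, `L > 0`): a state of the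
half box `Λ_{L/2}` and its translate by `(L/2, L/2, L/2)`. [folklore] -/
theorem exists_disjoint_trialStates {N : ℕ} (hN : 0 < N) {L : ℝ} (hL : 0 < L) :
    ∃ Ψ Φ : TrialState N L, ∀ X, Ψ.ψ X = 0 ∨ Φ.ψ X = 0 := by
  obtain ⟨Ψ₀⟩ := TrialState.nonempty hN (half_pos hL)
  let a : Space := WithLp.toLp 2 fun _ : Fin 3 => L / 2
  let A := Ψ₀.toSupported.translate a
  have hsub : {x : Space | x - a ∈ box (L / 2)} ⊆ box L := by
    intro x hx k
    have hk := hx k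
    simp only [a, PiLp.sub_apply, Set.mem_Ioo] at hk
    constructor <;> linarith [hk.1, hk.2]
  refine ⟨Ψ₀.enlarge (by linarith), (A.mono hsub).toTrialState, fun X => ?_⟩
  by_contra hX
  push Not at hX
  obtain ⟨h1, h2⟩ := hX
  -- `Ψ₀ X ≠ 0` forces `X ∈ Λ_{L/2}^N`
  have hX1 : X ∈ boxN N (L / 2) := by
    by_contra hc
    exact h1 (Ψ₀.eq_zero X hc)
  -- `Ψ₀ (X - a) ≠ 0` forces `X - a ∈ Λ_{L/2}^N`
  have hX2 : (X - fun _ => a) ∈ boxN N (L / 2) := by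
    by_contra hc
    exact h2 (Ψ₀.eq_zero _ hc)
  have k0 : Fin 3 := 0
  have i0 : Fin N := ⟨0, hN⟩
  have hlt := (hX1 i0 k0).2
  have hgt := (hX2 i0 k0).1
  simp only [Pi.sub_apply, PiLp.sub_apply, a] at hgt
  linarith

/-- **Infinite ground-state energy kills rigidity**: if `E₀(N, L) = ⊤` (`N ≥ 1`, `L > 0`) then every
trial state is a near-minimiser at every slack, in particular two disjointly supported ones.
Consequence for the line: any proof of the crux must in particular show `E₀ < ⊤` eventually
(hard cores must FIT at density `ρ < ρ₀`). [folklore] -/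
theorem not_rigidAt_of_groundStateEnergy_eq_top {v : ℝ → ℝ≥0∞} {N : ℕ} (hN : 0 < N) {L : ℝ}
    (hL : 0 < L) (hE : groundStateEnergy v N L = ⊤) : ¬ RigidAt v N L := by
  refine not_rigidAt_of_disjoint fun δ _ => ?_
  obtain ⟨Ψ, Φ, h⟩ := exists_disjoint_trialStates hN hL
  exact ⟨Ψ, Φ, h, by rw [hE, top_add]; exact le_top, by rw [hE, top_add]; exact le_top⟩

/-- An everywhere-infinite interaction on the support makes the energy infinite. [folklore] -/
theorem energy_eq_top_of_interaction_eq_top {N : ℕ} {L : ℝ} (v : ℝ → ℝ≥0∞) (Ψ : TrialState N L)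
    (h : ∀ X, Ψ.ψ X ≠ 0 → interaction v X = ⊤) : energy v Ψ = ⊤ := by
  have hm : Measurable fun X => (‖Ψ.ψ X‖₊ : ℝ≥0∞) ^ 2 :=
    (Ψ.contDiff.continuous.measurable.nnnorm.coe_nnreal_ennreal).pow_const 2
  have hpt : ∀ X, interaction v X * (‖Ψ.ψ X‖₊ : ℝ≥0∞) ^ 2 = ⊤ * (‖Ψ.ψ X‖₊ : ℝ≥0∞) ^ 2 := by
    intro X
    by_cases hX : Ψ.ψ X = 0
    · simp [hX]
    · rw [h X hX]
  apply eq_top_iff.2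
  calc (⊤ : ℝ≥0∞) = ⊤ * ∫⁻ X, (‖Ψ.ψ X‖₊ : ℝ≥0∞) ^ 2 := by rw [Ψ.norm_eq, mul_one]
    _ = ∫⁻ X, interaction v X * (‖Ψ.ψ X‖₊ : ℝ≥0∞) ^ 2 := by
        rw [← lintegral_const_mul _ hm]
        exact lintegral_congr fun X => (hpt X).symm
    _ ≤ energy v Ψ := lintegral_mono fun X => le_add_self

/-- If every trial state has infinite energy, `E₀ = ⊤`. [folklore] -/
theorem groundStateEnergy_eq_top_of_forall {v : ℝ → ℝ≥0∞} {N : ℕ} {L : ℝ}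
    (h : ∀ Ψ : TrialState N L, energy v Ψ = ⊤) : groundStateEnergy v N L = ⊤ := by
  unfold groundStateEnergy
  exact iInf_eq_top.2 h

/-! ## 2. Load-bearing hypothesis: FINITE RANGE (`∃ R₀, ∀ r > R₀, v r = 0`)

Dropping it admits `v ≡ ⊤`, for which `E₀(N, L) = ⊤` for every `N ≥ 2` and section 1 applies:
any proof of the crux must use the finite range of `v` (it is what makes the dilute component
nonempty). -/

/-- The crux with the finite-range clause of `IsRepulsiveFiniteRange` dropped (only measurability
of `v` kept). [folklore] -/
def GroundStateRigidityWithoutFiniteRange : Prop :=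
  ∀ v : ℝ → ℝ≥0∞, Measurable v → ∃ ρ₀ : ℝ, 0 < ρ₀ ∧
    ∀ ρ : ℝ, 0 < ρ → ρ < ρ₀ → ∀ᶠ N : ℕ in atTop, RigidAt v N (sideLength ρ N)

/-- For `v ≡ ⊤` and `N ≥ 2` the interaction is `⊤` at every configuration. [folklore] -/
theorem interaction_top_eq_top {N : ℕ} (hN : 2 ≤ N) (X : Config N) :
    interaction (fun _ => (⊤ : ℝ≥0∞)) X = ⊤ := by
  unfold interaction
  rw [ENNReal.sum_eq_top]
  refine ⟨⟨0, by omega⟩, Finset.mem_univ _, ?_⟩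
  rw [ENNReal.sum_eq_top]
  exact ⟨⟨1, by omega⟩, by simp [Finset.mem_filter, Fin.lt_def], rfl⟩

/-- **`GroundStateRigidity` is false without the finite-range hypothesis** (witness `v ≡ ⊤`:
`E₀ = ⊤` for all `N ≥ 2`, and two disjoint trial states are `⊤`-near-minimisers at distance `2`).
[folklore] -/
theorem groundStateRigidity_false_without_finiteRange : ¬ GroundStateRigidityWithoutFiniteRange := by
  intro h
  obtain ⟨ρ₀, hρ₀, h⟩ := h (fun _ => ⊤) measurable_const
  have h' := h (ρ₀ / 2) (half_pos hρ₀) (half_lt_self hρ₀)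
  obtain ⟨N, hN2, hR⟩ := ((eventually_ge_atTop 2).and h').exists
  refine not_rigidAt_of_groundStateEnergy_eq_top (v := fun _ => ⊤) (by omega)
    (sideLength_pos (half_pos hρ₀) (by omega)) ?_ hR
  exact groundStateEnergy_eq_top_of_forall fun Ψ =>
    energy_eq_top_of_interaction_eq_top _ Ψ fun X _ => interaction_top_eq_top hN2 X

/-! ## 3. Load-bearing hypothesis: LOW DENSITY (`∃ ρ₀, ∀ ρ < ρ₀`)

The all-densities strengthening is false: unit hard spheres at density `64` are jammed out of
existence for all large `N` (pigeonhole in cells of side `1/2`), so `E₀ = ⊤` eventually. -/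

/-- The crux demanded at EVERY density `ρ > 0` (no `ρ₀`). [folklore] -/
def GroundStateRigidityAtAllDensities : Prop :=
  ∀ v : ℝ → ℝ≥0∞, IsRepulsiveFiniteRange v → ∀ ρ : ℝ, 0 < ρ →
    ∀ᶠ N : ℕ in atTop, RigidAt v N (sideLength ρ N)

/-- Unit hard spheres: `v = ⊤ · 1_{[0, 1]}` (admissible: measurable, range `1`). [folklore] -/
def hardSphere : ℝ → ℝ≥0∞ := fun r => if r ≤ 1 then ⊤ else 0

/-- `hardSphere` is an admissible (repulsive, finite-range) interaction. [folklore] -/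
theorem isRepulsiveFiniteRange_hardSphere : IsRepulsiveFiniteRange hardSphere := by
  refine ⟨Measurable.ite measurableSet_Iic measurable_const measurable_const, 1, fun r hr => ?_⟩
  simp [hardSphere, not_le.2 hr]

/-- Equal `⌊2a⌋₊ = ⌊2b⌋₊` for `a, b ≥ 0` forces `|a - b| < 1/2`. [folklore] -/
theorem abs_sub_lt_half_of_floor_eq {a b : ℝ} (ha : 0 ≤ a) (hb : 0 ≤ b)
    (h : ⌊2 * a⌋₊ = ⌊2 * b⌋₊) : |a - b| < 1 / 2 := by
  have ha1 := Nat.floor_le (by linarith : 0 ≤ 2 * a)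
  have ha2 := Nat.lt_floor_add_one (2 * a)
  have hb1 := Nat.floor_le (by linarith : 0 ≤ 2 * b)
  have hb2 := Nat.lt_floor_add_one (2 * b)
  rw [h] at ha1 ha2
  rw [abs_sub_lt_iff]
  constructor <;> linarith

/-- **Pigeonhole**: `N > ⌈2L⌉₊³` points of the box `Λ_L` contain two at distance `≤ 1` (cells of
side `1/2` have diameter `√3/2 < 1`). [folklore] -/
theorem exists_dist_le_one {N : ℕ} {L : ℝ} {X : Config N} (hX : X ∈ boxN N L)
    (hN : ⌈2 * L⌉₊ ^ 3 < N) : ∃ i j : Fin N, i < j ∧ dist (X i) (X j) ≤ 1 := by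
  set K : ℕ := ⌈2 * L⌉₊ with hK
  have hcoord : ∀ (i : Fin N) (k : Fin 3), 0 ≤ X i k ∧ ⌊2 * X i k⌋₊ < K := by
    intro i k
    have h := hX i k
    refine ⟨h.1.le, ?_⟩
    rw [Nat.floor_lt (by linarith [h.1])]
    calc 2 * X i k < 2 * L := by linarith [h.2]
      _ ≤ K := Nat.le_ceil _
  let cell : Fin N → (Fin 3 → Fin K) := fun i k => ⟨⌊2 * X i k⌋₊, (hcoord i k).2⟩
  have hcard : Fintype.card (Fin 3 → Fin K) < Fintype.card (Fin N) := by
    simpa using hN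
  obtain ⟨i, j, hij, hcell⟩ := Fintype.exists_ne_map_eq_of_card_lt cell hcard
  have hclose : ∀ k : Fin 3, dist (X i k) (X j k) ≤ 1 / 2 := by
    intro k
    have hk : ⌊2 * X i k⌋₊ = ⌊2 * X j k⌋₊ := by
      have := congrFun hcell k
      simpa [cell] using this
    rw [Real.dist_eq]
    exact (abs_sub_lt_half_of_floor_eq (hcoord i k).1 (hcoord j k).1 hk).le
  have hdist : dist (X i) (X j) ≤ 1 := by
    rw [EuclideanSpace.dist_eq]
    have hsum : ∑ k, dist (X i k) (X j k) ^ 2 ≤ 1 := by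
      have hk : ∀ k : Fin 3, dist (X i k) (X j k) ^ 2 ≤ (1 / 2) ^ 2 := fun k =>
        pow_le_pow_left₀ dist_nonneg (hclose k) 2
      calc ∑ k, dist (X i k) (X j k) ^ 2 ≤ ∑ _k : Fin 3, (1 / 2 : ℝ) ^ 2 :=
            Finset.sum_le_sum fun k _ => hk k
        _ ≤ 1 := by simp; norm_num
    calc Real.sqrt (∑ k, dist (X i k) (X j k) ^ 2) ≤ Real.sqrt 1 := Real.sqrt_le_sqrt hsum
      _ = 1 := Real.sqrt_one
  rcases lt_or_gt_of_ne hij with hlt | hlt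
  · exact ⟨i, j, hlt, hdist⟩
  · exact ⟨j, i, hlt, by rwa [dist_comm]⟩

/-- With more than `⌈2L⌉₊³` unit hard spheres in `Λ_L` the interaction is `⊤` everywhere in the
box. [folklore] -/
theorem interaction_hardSphere_eq_top {N : ℕ} {L : ℝ} {X : Config N} (hX : X ∈ boxN N L)
    (hN : ⌈2 * L⌉₊ ^ 3 < N) : interaction hardSphere X = ⊤ := by
  obtain ⟨i, j, hij, hd⟩ := exists_dist_le_one hX hN
  unfold interaction
  rw [ENNReal.sum_eq_top]
  refine ⟨i, Finset.mem_univ _, ?_⟩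
  rw [ENNReal.sum_eq_top]
  exact ⟨j, by simp [hij], by simp [hardSphere, hd]⟩

/-- Hence `E₀(N, L) = ⊤` for unit hard spheres once `N > ⌈2L⌉₊³`. [folklore] -/
theorem groundStateEnergy_hardSphere_eq_top {N : ℕ} {L : ℝ} (hN : ⌈2 * L⌉₊ ^ 3 < N) :
    groundStateEnergy hardSphere N L = ⊤ := by
  refine groundStateEnergy_eq_top_of_forall fun Ψ => energy_eq_top_of_interaction_eq_top _ Ψ ?_
  intro X hX
  have hXb : X ∈ boxN N L := by
    by_contra hc
    exact hX (Ψ.eq_zero X hc)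
  exact interaction_hardSphere_eq_top hXb hN

/-- Density bookkeeping: at density `64`, `⌈2L⌉₊³ < N` for all `N ≥ 64` (`L³ = N/64`, `L ≥ 1`,
`⌈2L⌉₊ < 2L + 1 ≤ 3L`). [folklore] -/
theorem ceil_cube_lt {N : ℕ} (hN : 64 ≤ N) : ⌈2 * sideLength 64 N⌉₊ ^ 3 < N := by
  set L := sideLength 64 N with hLdef
  have hN0 : 0 < N := by omega
  have hL : 0 < L := sideLength_pos (by norm_num) hN0
  have hL3 : L ^ 3 = N / 64 := sideLength_pow_three (by norm_num) hN0
  have hNr : (64 : ℝ) ≤ N := by exact_mod_cast hN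
  have hL1 : 1 ≤ L := by
    by_contra hc
    push Not at hc
    have : L ^ 3 < 1 ^ 3 := pow_lt_pow_left₀ hc hL.le three_ne_zero
    rw [hL3, one_pow, div_lt_one (by norm_num)] at this
    linarith
  have hceil : (⌈2 * L⌉₊ : ℝ) < 2 * L + 1 := Nat.ceil_lt_add_one (by linarith)
  have h3 : (⌈2 * L⌉₊ : ℝ) < 3 * L := by linarith
  have hcube : ((⌈2 * L⌉₊ : ℕ) : ℝ) ^ 3 < (3 * L) ^ 3 :=
    pow_lt_pow_left₀ h3 (Nat.cast_nonneg _) three_ne_zero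
  have hfin : ((⌈2 * L⌉₊ : ℕ) : ℝ) ^ 3 < N := by
    calc ((⌈2 * L⌉₊ : ℕ) : ℝ) ^ 3 < (3 * L) ^ 3 := hcube
      _ = 27 * (N / 64) := by rw [mul_pow, hL3]; norm_num
      _ ≤ N := by linarith
  exact_mod_cast hfin

/-- **`GroundStateRigidity` is false at all densities** (witness: unit hard spheres at `ρ = 64`;
for every `N ≥ 64` the box `Λ_L`, `L³ = N/64`, cannot hold `N` centres at mutual distance `> 1`,
so `E₀ = ⊤` and rigidity fails by section 1). Any proof of the crux must use `ρ < ρ₀(v)`.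
[folklore] -/
theorem groundStateRigidity_false_at_all_densities : ¬ GroundStateRigidityAtAllDensities := by
  intro h
  have h' := h hardSphere isRepulsiveFiniteRange_hardSphere 64 (by norm_num)
  obtain ⟨N, hN, hR⟩ := ((eventually_ge_atTop 64).and h').exists
  exact not_rigidAt_of_groundStateEnergy_eq_top (by omega) (sideLength_pos (by norm_num) (by omega))
    (groundStateEnergy_hardSphere_eq_top (ceil_cube_lt hN)) hR

/-! ## 4. SMALL-MODEL DEGENERACY: two unit hard spheres in a box with `1/3 < L² < 1/2`

The hard-core mechanism of every why-might-fail, kernel-checked in its smallest instance (sub-namespace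
`SmallModel`; landed copy: `Theorems/GroundStateRigidity/Negative/TwoHardSpheres.lean`).  Plan of the proof:
`E₀ < ⊤` (corner witness via `TrialState.combine`); finite energy ⇒ `Ψ = 0` on `{|x₁-x₂| < 1}` ⇒ on the
support `|q| > 1 - 2L²`, `q = (x₁-x₂)₀(x₁-x₂)₁` Bose-symmetric and odd under the reflection `x₀ ↦ L - x₀`;
the reflection preserves energy and norm (linear involution, `|det| = 1`); localise a near-minimiser to the
heavier class with the flat cut-off `step(q)` (`∇(cut·Ψ) = cut·∇Ψ`), renormalise (mass `≥ 1/2` ⇒ slack at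
most doubles), reflect: two disjoint near-minimisers ⇒ `¬ RigidAt hardSphere 2 L`. -/

namespace SmallModel

variable {N : ℕ}

/-! ### Reflection of the box in its first coordinate plane -/

/-- Sign flip of the first Cartesian coordinate of every particle (linear part of the reflection). -/
def negC (N : ℕ) : Config N →ₗ[ℝ] Config N where
  toFun X := fun i => WithLp.toLp 2 fun k => if k = 0 then -(X i k) else X i k
  map_add' X Y := by
    funext i
    ext k
    by_cases hk : k = 0 <;> simp [hk] ; ring
  map_smul' c X := by
    funext i
    ext k
    by_cases hk : k = 0 <;> simp [hk]

theorem negC_apply (X : Config N) (i : Fin N) (k : Fin 3) :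
    negC N X i k = if k = 0 then -(X i k) else X i k := rfl

theorem negC_negC (X : Config N) : negC N (negC N X) = X := by
  funext i
  ext k
  by_cases hk : k = 0 <;> simp [negC_apply, hk]

/-- The shift `(L, 0, 0)` of every particle. -/
def shiftC (N : ℕ) (L : ℝ) : Config N := fun _ => WithLp.toLp 2 fun k => if k = 0 then L else 0

/-- Reflection `x₀ ↦ L - x₀` of the first coordinate of every particle. -/
def reflC (L : ℝ) (X : Config N) : Config N := negC N X + shiftC N L

theorem reflC_apply (L : ℝ) (X : Config N) (i : Fin N) (k : Fin 3) :
    reflC L X i k = if k = 0 then L - X i k else X i k := by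
  simp only [reflC, Pi.add_apply, PiLp.add_apply, negC_apply, shiftC]
  by_cases hk : k = 0 <;> simp [hk] ; ring

theorem reflC_reflC (L : ℝ) (X : Config N) : reflC L (reflC L X) = X := by
  funext i
  ext k
  by_cases hk : k = 0 <;> simp [reflC_apply, hk]

theorem reflC_comp_perm (L : ℝ) (X : Config N) (σ : Equiv.Perm (Fin N)) :
    reflC L (X ∘ σ) = reflC L X ∘ σ := by
  funext i
  ext k
  simp [reflC_apply]

theorem dist_reflC (L : ℝ) (X : Config N) (i j : Fin N) :
    dist (reflC L X i) (reflC L X j) = dist (X i) (X j) := by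
  simp only [EuclideanSpace.dist_eq]
  congr 1
  refine Finset.sum_congr rfl fun k _ => ?_
  by_cases hk : k = 0
  · subst hk
    simp only [reflC_apply, if_true, Real.dist_eq]
    rw [show L - X i 0 - (L - X j 0) = -(X i 0 - X j 0) by ring, abs_neg]
  · simp [reflC_apply, hk, Real.dist_eq]

theorem interaction_reflC (v : ℝ → ℝ≥0∞) (L : ℝ) (X : Config N) :
    interaction v (reflC L X) = interaction v X := by
  simp only [interaction, dist_reflC]

theorem mem_boxN_reflC {L : ℝ} {X : Config N} : reflC L X ∈ boxN N L ↔ X ∈ boxN N L := by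
  simp only [boxN, box, Set.mem_setOf_eq, Set.mem_Ioo]
  constructor
  · intro h i k
    have := h i k
    by_cases hk : k = 0
    · subst hk
      simp only [reflC_apply, if_true] at this
      constructor <;> linarith [this.1, this.2]
    · simpa [reflC_apply, hk] using this
  · intro h i k
    have := h i k
    by_cases hk : k = 0
    · subst hk
      simp only [reflC_apply, if_true]
      constructor <;> linarith [this.1, this.2]
    · simpa [reflC_apply, hk] using this

/-- The linear part is an involution, so `|det| = 1`. -/
theorem abs_det_negC : |LinearMap.det (negC N)| = 1 := by
  have h2 : (negC N).comp (negC N) = LinearMap.id := by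
    ext X i k
    simp [negC_negC]
  have hdet : LinearMap.det (negC N) * LinearMap.det (negC N) = 1 := by
    rw [← LinearMap.det_comp, h2, LinearMap.det_id]
  have := congrArg abs hdet
  rw [abs_mul, abs_one] at this
  nlinarith [abs_nonneg (LinearMap.det (negC N))]

theorem continuous_negC : Continuous (negC N) :=
  LinearMap.continuous_of_finiteDimensional _

theorem continuous_reflC (L : ℝ) : Continuous (reflC (N := N) L) :=
  continuous_negC.add continuous_const

/-- The reflection as a homeomorphism (its own inverse). -/
def reflHomeo (N : ℕ) (L : ℝ) : Config N ≃ₜ Config N where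
  toFun := reflC L
  invFun := reflC L
  left_inv := reflC_reflC L
  right_inv := reflC_reflC L
  continuous_toFun := continuous_reflC L
  continuous_invFun := continuous_reflC L

theorem map_negC_volume : Measure.map (negC N) (volume : Measure (Config N)) = volume := by
  have hdet : LinearMap.det (negC N) ≠ 0 := by
    intro h
    have := abs_det_negC (N := N)
    rw [h, abs_zero] at this
    exact zero_ne_one this
  rw [Measure.map_linearMap_addHaar_eq_smul_addHaar _ hdet, abs_inv, abs_det_negC, inv_one,
    ENNReal.ofReal_one, one_smul]

theorem measurePreserving_reflC (L : ℝ) :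
    MeasurePreserving (reflC (N := N) L) (volume : Measure (Config N)) volume := by
  have h1 : MeasurePreserving (negC N) (volume : Measure (Config N)) volume :=
    ⟨continuous_negC.measurable, map_negC_volume⟩
  have h2 : MeasurePreserving (fun X : Config N => X + shiftC N L) volume volume :=
    measurePreserving_add_right volume (shiftC N L)
  exact h2.comp h1

theorem lintegral_comp_reflC (L : ℝ) (f : Config N → ℝ≥0∞) :
    ∫⁻ X, f (reflC L X) = ∫⁻ X, f X :=
  (measurePreserving_reflC L).lintegral_comp_emb (reflHomeo N L).measurableEmbedding f

/-- `negC` as a continuous linear map, the derivative of `reflC`. -/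
def negCL (N : ℕ) : Config N →L[ℝ] Config N := LinearMap.toContinuousLinearMap (negC N)

theorem hasFDerivAt_reflC (L : ℝ) (X : Config N) : HasFDerivAt (reflC L) (negCL N) X := by
  have h1 : HasFDerivAt (negC N) (negCL N) X := (negCL N).hasFDerivAt
  exact h1.add_const (shiftC N L)

theorem contDiff_reflC (L : ℝ) : ContDiff ℝ 1 (reflC (N := N) L) :=
  ((negCL N).contDiff).add contDiff_const

theorem negCL_single (i : Fin N) (k : Fin 3) :
    negCL N (Pi.single i (EuclideanSpace.single k (1 : ℝ))) =
      (if k = 0 then (-1 : ℝ) else 1) • Pi.single i (EuclideanSpace.single k (1 : ℝ)) := by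
  funext j
  ext k'
  simp only [negCL, LinearMap.coe_toContinuousLinearMap', negC_apply, Pi.smul_apply, PiLp.smul_apply,
    smul_eq_mul]
  by_cases hj : j = i
  · subst hj
    simp only [Pi.single_eq_same]
    by_cases hk' : k' = 0
    · subst hk'
      by_cases hk : k = 0
      · subst hk; simp
      · simp [hk, Ne.symm hk]
    · simp only [hk', if_false]
      by_cases hk : k = 0
      · subst hk; simp [hk']
      · simp [hk]
  · simp [Pi.single_eq_of_ne hj]

theorem kineticDensity_comp_reflC {ψ : Config N → ℂ} (hψ : ContDiff ℝ 1 ψ) (L : ℝ) (X : Config N) :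
    kineticDensity (fun Y => ψ (reflC L Y)) X = kineticDensity ψ (reflC L X) := by
  have hd : fderiv ℝ (fun Y => ψ (reflC L Y)) X = (fderiv ℝ ψ (reflC L X)).comp (negCL N) := by
    have h1 : HasFDerivAt ψ (fderiv ℝ ψ (reflC L X)) (reflC L X) :=
      ((hψ.differentiable one_ne_zero) _).hasFDerivAt
    exact (h1.comp X (hasFDerivAt_reflC L X)).fderiv
  simp only [kineticDensity, hd, ContinuousLinearMap.comp_apply, negCL_single, map_smul]
  refine Finset.sum_congr rfl fun i _ => Finset.sum_congr rfl fun k _ => ?_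
  by_cases hk : k = 0 <;> simp [hk, nnnorm_neg]

/-- Reflection of a trial state in the plane `x₀ = L/2`. -/
def reflectTS {L : ℝ} (Ψ : TrialState N L) : TrialState N L where
  ψ X := Ψ.ψ (reflC L X)
  contDiff := Ψ.contDiff.comp (contDiff_reflC L)
  eq_zero X hX := Ψ.eq_zero _ (fun h => hX (mem_boxN_reflC.1 h))
  symm σ X := by
    show Ψ.ψ (reflC L (X ∘ σ)) = Ψ.ψ (reflC L X)
    rw [reflC_comp_perm, Ψ.symm]
  norm_eq := by
    rw [lintegral_comp_reflC L (fun X => (‖Ψ.ψ X‖₊ : ℝ≥0∞) ^ 2)]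
    exact Ψ.norm_eq

@[simp] theorem reflectTS_ψ {L : ℝ} (Ψ : TrialState N L) (X : Config N) :
    (reflectTS Ψ).ψ X = Ψ.ψ (reflC L X) := rfl

theorem energy_reflectTS {L : ℝ} (v : ℝ → ℝ≥0∞) (Ψ : TrialState N L) :
    energy v (reflectTS Ψ) = energy v Ψ := by
  unfold energy
  rw [← lintegral_comp_reflC L (fun X => kineticDensity Ψ.ψ X + interaction v X * (‖Ψ.ψ X‖₊ : ℝ≥0∞) ^ 2)]
  refine lintegral_congr fun X => ?_
  show kineticDensity (fun Y => Ψ.ψ (reflC L Y)) X + interaction v X * _ = _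
  rw [kineticDensity_comp_reflC Ψ.contDiff, interaction_reflC]
  rfl


/-! ### Two unit hard spheres in a small box: geometry -/

theorem hardSphere_of_le_one {r : ℝ} (hr : r ≤ 1) : hardSphere r = ⊤ := by simp [hardSphere, hr]

/-- The class function `q(X) = (x₁ - x₂)₀ · (x₁ - x₂)₁` (product of the first two components of the
relative coordinate): Bose symmetric, odd under the reflection `reflC`. -/
def qfun (X : Config 2) : ℝ := (X 0 0 - X 1 0) * (X 0 1 - X 1 1)

theorem continuous_qfun : Continuous qfun := by
  unfold qfun
  fun_prop

theorem qfun_reflC (L : ℝ) (X : Config 2) : qfun (reflC L X) = -qfun X := by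
  simp [qfun, reflC_apply]
  ring

theorem fin_two_eq (i : Fin 2) : i = 0 ∨ i = 1 := by
  rcases i with ⟨i, hi⟩
  interval_cases i
  · exact Or.inl rfl
  · exact Or.inr rfl

theorem qfun_comp_perm (σ : Equiv.Perm (Fin 2)) (X : Config 2) : qfun (X ∘ σ) = qfun X := by
  rcases fin_two_eq (σ 0) with h0 | h0
  · have h1 : σ 1 = 1 := by
      rcases fin_two_eq (σ 1) with h1 | h1
      · exact absurd (σ.injective (h1.trans h0.symm)) (by decide)
      · exact h1
    simp [qfun, h0, h1]
  · have h1 : σ 1 = 0 := by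
      rcases fin_two_eq (σ 1) with h1 | h1
      · exact h1
      · exact absurd (σ.injective (h1.trans h0.symm)) (by decide)
    simp [qfun, h0, h1]
    ring

/-- In a box with `2L² < 1`, two centres at distance `≥ 1` have `|q| > 1 - 2L²`: every component
of the relative coordinate exceeds `√(1 - 2L²)` in absolute value. -/
theorem lt_abs_qfun {L : ℝ} {X : Config 2} (hX : X ∈ boxN 2 L)
    (hd : 1 ≤ dist (X 0) (X 1)) : 1 - 2 * L ^ 2 < |qfun X| := by
  have hc : ∀ (i : Fin 2) (k : Fin 3), 0 < X i k ∧ X i k < L := fun i k => hX i k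
  have hsq : 1 ≤ ∑ k, (X 0 k - X 1 k) ^ 2 := by
    have h1 : (1 : ℝ) ≤ dist (X 0) (X 1) ^ 2 := by nlinarith
    rw [EuclideanSpace.dist_eq, Real.sq_sqrt (Finset.sum_nonneg fun k _ => sq_nonneg _)] at h1
    simpa [Real.dist_eq, sq_abs] using h1
  simp only [Fin.sum_univ_three] at hsq
  have b0 := hc 0 0; have b1 := hc 0 1; have b2 := hc 0 2
  have c0 := hc 1 0; have c1 := hc 1 1; have c2 := hc 1 2
  have hd2 : (X 0 2 - X 1 2) ^ 2 < L ^ 2 := by nlinarith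
  have hd1 : (X 0 1 - X 1 1) ^ 2 < L ^ 2 := by nlinarith
  have hd0 : (X 0 0 - X 1 0) ^ 2 < L ^ 2 := by nlinarith
  have e0 : 1 - 2 * L ^ 2 < (X 0 0 - X 1 0) ^ 2 := by linarith
  have e1 : 1 - 2 * L ^ 2 < (X 0 1 - X 1 1) ^ 2 := by linarith
  -- `|q|² = d₀² d₁² > (1 - 2L²)²` when `1 - 2L² ≥ 0`; if `1 - 2L² < 0` the claim is trivial
  by_cases hg : 0 ≤ 1 - 2 * L ^ 2
  · have hq2 : (1 - 2 * L ^ 2) ^ 2 < qfun X ^ 2 := by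
      have : qfun X ^ 2 = (X 0 0 - X 1 0) ^ 2 * (X 0 1 - X 1 1) ^ 2 := by simp [qfun]; ring
      rw [this]
      calc (1 - 2 * L ^ 2) ^ 2 = (1 - 2 * L ^ 2) * (1 - 2 * L ^ 2) := by ring
        _ < (X 0 0 - X 1 0) ^ 2 * (X 0 1 - X 1 1) ^ 2 := by
            apply mul_lt_mul'' e0 e1 hg hg
    have := sq_lt_sq.1 hq2
    rwa [abs_of_nonneg hg] at this
  · push Not at hg
    exact hg.trans_le (abs_nonneg _)


/-! ### Finite energy forces vanishing on the collision region -/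

/-- A continuous function that does not vanish at a point of an open set has positive `L²` mass on it. -/
theorem setLIntegral_pos_of_continuous {f : Config N → ℂ} (hf : Continuous f) {S : Set (Config N)}
    (hS : IsOpen S) {X : Config N} (hX : X ∈ S) (hfX : f X ≠ 0) :
    0 < ∫⁻ Y in S, (‖f Y‖₊ : ℝ≥0∞) ^ 2 := by
  have hpos : 0 < ‖f X‖ := norm_pos_iff.2 hfX
  set T : Set (Config N) := S ∩ {Y | ‖f X‖ / 2 < ‖f Y‖} with hT
  have hTo : IsOpen T := hS.inter (isOpen_lt continuous_const hf.norm)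
  have hXT : X ∈ T := ⟨hX, by show ‖f X‖ / 2 < ‖f X‖; linarith⟩
  obtain ⟨r, hr, hball⟩ := Metric.isOpen_iff.1 hTo X hXT
  have hc : ∀ Y ∈ ball X r, ENNReal.ofReal (‖f X‖ / 2) ^ 2 ≤ (‖f Y‖₊ : ℝ≥0∞) ^ 2 := by
    intro Y hY
    have h := (hball hY).2
    have : ENNReal.ofReal (‖f X‖ / 2) ≤ (‖f Y‖₊ : ℝ≥0∞) := by
      rw [← enorm_eq_nnnorm, ← ofReal_norm]
      exact ENNReal.ofReal_le_ofReal h.le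
    gcongr
  calc (0 : ℝ≥0∞) < ENNReal.ofReal (‖f X‖ / 2) ^ 2 * volume (ball X r) := by
        refine ENNReal.mul_pos ?_ (measure_ball_pos volume X hr).ne'
        exact (ENNReal.pow_pos (ENNReal.ofReal_pos.2 (by linarith)) 2).ne'
    _ = ∫⁻ _ in ball X r, ENNReal.ofReal (‖f X‖ / 2) ^ 2 := (setLIntegral_const _ _).symm
    _ ≤ ∫⁻ Y in ball X r, (‖f Y‖₊ : ℝ≥0∞) ^ 2 := setLIntegral_mono' measurableSet_ball hc
    _ ≤ ∫⁻ Y in S, (‖f Y‖₊ : ℝ≥0∞) ^ 2 :=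
        lintegral_mono_set (fun Y hY => (hball hY).1)

/-- For two unit hard spheres the interaction is `⊤` whenever the centres are within distance `1`. -/
theorem interaction_two_eq_top {X : Config 2} (hX : dist (X 0) (X 1) ≤ 1) :
    interaction hardSphere X = ⊤ := by
  unfold interaction
  rw [ENNReal.sum_eq_top]
  refine ⟨0, Finset.mem_univ _, ?_⟩
  rw [ENNReal.sum_eq_top]
  exact ⟨1, by simp, hardSphere_of_le_one hX⟩

/-- **Finite energy ⇒ the wave function vanishes on the open collision region** `{|x₁ - x₂| < 1}`. -/
theorem eq_zero_of_dist_lt_one {L : ℝ} (Ψ : TrialState 2 L) (hE : energy hardSphere Ψ ≠ ⊤)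
    {X : Config 2} (hX : dist (X 0) (X 1) < 1) : Ψ.ψ X = 0 := by
  by_contra h
  set S : Set (Config 2) := {Y | dist (Y 0) (Y 1) < 1} with hSdef
  have hS : IsOpen S := isOpen_lt (by fun_prop) continuous_const
  have hpos := setLIntegral_pos_of_continuous Ψ.contDiff.continuous hS (show X ∈ S from hX) h
  have hm : Measurable fun Y => (‖Ψ.ψ Y‖₊ : ℝ≥0∞) ^ 2 :=
    (Ψ.contDiff.continuous.measurable.nnnorm.coe_nnreal_ennreal).pow_const 2
  apply hE
  apply eq_top_iff.2
  calc (⊤ : ℝ≥0∞) = ⊤ * ∫⁻ Y in S, (‖Ψ.ψ Y‖₊ : ℝ≥0∞) ^ 2 := (ENNReal.top_mul hpos.ne').symm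
    _ = ∫⁻ Y in S, ⊤ * (‖Ψ.ψ Y‖₊ : ℝ≥0∞) ^ 2 := (lintegral_const_mul _ hm).symm
    _ = ∫⁻ Y in S, interaction hardSphere Y * (‖Ψ.ψ Y‖₊ : ℝ≥0∞) ^ 2 := by
        refine setLIntegral_congr_fun hS.measurableSet (fun Y hY => ?_)
        rw [interaction_two_eq_top (le_of_lt hY)]
    _ ≤ ∫⁻ Y, interaction hardSphere Y * (‖Ψ.ψ Y‖₊ : ℝ≥0∞) ^ 2 := setLIntegral_le_lintegral _ _
    _ ≤ energy hardSphere Ψ := lintegral_mono fun Y => le_add_self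

/-- **Support dichotomy** (`2L² < 1`): wherever a finite-energy two-body state is nonzero,
`|q| > 1 - 2L²`. -/
theorem lt_abs_qfun_of_ne_zero {L : ℝ} (Ψ : TrialState 2 L) (hE : energy hardSphere Ψ ≠ ⊤)
    {X : Config 2} (hX : Ψ.ψ X ≠ 0) : 1 - 2 * L ^ 2 < |qfun X| := by
  have hXb : X ∈ boxN 2 L := by
    by_contra hc
    exact hX (Ψ.eq_zero X hc)
  have hd : 1 ≤ dist (X 0) (X 1) := by
    by_contra hc
    push Not at hc
    exact hX (eq_zero_of_dist_lt_one Ψ hE hc)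
  exact lt_abs_qfun hXb hd

/-- On the open set `{|q| < 1 - 2L²}` a finite-energy state vanishes identically near every point. -/
theorem eventuallyEq_zero {L : ℝ} (Ψ : TrialState 2 L) (hE : energy hardSphere Ψ ≠ ⊤)
    {X : Config 2} (hq : |qfun X| < 1 - 2 * L ^ 2) : Ψ.ψ =ᶠ[𝓝 X] fun _ => 0 := by
  have hO : IsOpen {Y : Config 2 | |qfun Y| < 1 - 2 * L ^ 2} :=
    isOpen_lt (continuous_qfun.abs) continuous_const
  refine Filter.eventuallyEq_of_mem (hO.mem_nhds hq) fun Y hY => ?_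
  by_contra h
  exact absurd (lt_abs_qfun_of_ne_zero Ψ hE h) (not_lt.2 (le_of_lt hY))

theorem fderiv_eq_zero_of_abs_qfun_lt {L : ℝ} (Ψ : TrialState 2 L) (hE : energy hardSphere Ψ ≠ ⊤)
    {X : Config 2} (hq : |qfun X| < 1 - 2 * L ^ 2) : fderiv ℝ Ψ.ψ X = 0 := by
  rw [(eventuallyEq_zero Ψ hE hq).fderiv_eq]
  exact fderiv_const_apply _

theorem kineticDensity_eq_zero_of_abs_qfun_lt {L : ℝ} (Ψ : TrialState 2 L)
    (hE : energy hardSphere Ψ ≠ ⊤) {X : Config 2} (hq : |qfun X| < 1 - 2 * L ^ 2) :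
    kineticDensity Ψ.ψ X = 0 := by
  simp [kineticDensity, fderiv_eq_zero_of_abs_qfun_lt Ψ hE hq]

/-! ### The smooth class cut-off -/

/-- Smooth step: `0` on `(-∞, -g]`, `1` on `[g, ∞)`. -/
def step (g t : ℝ) : ℝ := Real.smoothTransition ((t + g) / (2 * g))

theorem step_of_le {g t : ℝ} (hg : 0 < g) (ht : g ≤ t) : step g t = 1 :=
  Real.smoothTransition.one_of_one_le (by rw [le_div_iff₀ (by linarith)]; linarith)

theorem step_of_le_neg {g t : ℝ} (hg : 0 < g) (ht : t ≤ -g) : step g t = 0 :=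
  Real.smoothTransition.zero_of_nonpos (div_nonpos_of_nonpos_of_nonneg (by linarith) (by linarith))

theorem step_nonneg (g t : ℝ) : 0 ≤ step g t := Real.smoothTransition.nonneg _

theorem step_le_one (g t : ℝ) : step g t ≤ 1 := Real.smoothTransition.le_one _

theorem contDiff_step (g : ℝ) : ContDiff ℝ 1 (step g) := by
  unfold step
  exact Real.smoothTransition.contDiff.comp ((contDiff_id.add contDiff_const).div_const _)

/-- Beyond the threshold the two cut-offs `step g t`, `step g (-t)` are `{1, 0}` or `{0, 1}`. -/
theorem step_dichotomy {g t : ℝ} (hg : 0 < g) (ht : g ≤ |t|) :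
    (step g t = 1 ∧ step g (-t) = 0) ∨ (step g t = 0 ∧ step g (-t) = 1) := by
  rcases le_abs'.1 ht with h | h
  · exact Or.inr ⟨step_of_le_neg hg h, step_of_le hg (by linarith)⟩
  · exact Or.inl ⟨step_of_le hg h, step_of_le_neg hg (by linarith)⟩

/-! ### Localisation of a finite-energy two-body state to the class `{q > 0}` -/

theorem contDiff_qfun : ContDiff ℝ 1 qfun := by
  unfold qfun
  fun_prop

/-- The complex cut-off multiplier `X ↦ step g (q X)`. -/
def cut (g : ℝ) (X : Config 2) : ℂ := ((step g (qfun X) : ℝ) : ℂ)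

theorem contDiff_cut (g : ℝ) : ContDiff ℝ 1 (cut g) :=
  Complex.ofRealCLM.contDiff.comp ((contDiff_step g).comp contDiff_qfun)

theorem coe_nnnorm_cut (g : ℝ) (X : Config 2) :
    (‖cut g X‖₊ : ℝ≥0∞) = ENNReal.ofReal (step g (qfun X)) := by
  rw [cut, Complex.nnnorm_real, ← enorm_eq_nnnorm, Real.enorm_eq_ofReal (step_nonneg _ _)]

/-- The `[0,1]`-weight `W = |cut|²`. -/
def wt (g : ℝ) (X : Config 2) : ℝ≥0∞ := (‖cut g X‖₊ : ℝ≥0∞) ^ 2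

theorem wt_eq (g : ℝ) (X : Config 2) : wt g X = ENNReal.ofReal (step g (qfun X)) ^ 2 := by
  rw [wt, coe_nnnorm_cut]

theorem wt_add_wt_reflC {g L : ℝ} (hg : 0 < g) {X : Config 2} (hq : g ≤ |qfun X|) :
    wt g X + wt g (reflC L X) = 1 := by
  simp only [wt_eq, qfun_reflC]
  rcases step_dichotomy hg hq with ⟨h1, h2⟩ | ⟨h1, h2⟩
  · simp [h1, h2]
  · simp [h1, h2]

theorem wt_le_one (g : ℝ) (X : Config 2) : wt g X ≤ 1 := by
  rw [wt_eq]
  calc ENNReal.ofReal (step g (qfun X)) ^ 2 ≤ (1 : ℝ≥0∞) ^ 2 := by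
        gcongr
        rw [← ENNReal.ofReal_one]
        exact ENNReal.ofReal_le_ofReal (step_le_one _ _)
    _ = 1 := one_pow 2

/-- near points where `cut` is locally constant its derivative vanishes -/
theorem fderiv_cut_eq_zero {g : ℝ} (hg : 0 < g) {X : Config 2} (hq : g < |qfun X|) :
    fderiv ℝ (cut g) X = 0 := by
  rcases lt_abs.1 hq with h | h
  · -- `q > g` near `X`: `cut = 1`
    have hO : IsOpen {Y : Config 2 | g < qfun Y} := isOpen_lt continuous_const continuous_qfun
    have hev : cut g =ᶠ[𝓝 X] fun _ => (1 : ℂ) :=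
      Filter.eventuallyEq_of_mem (hO.mem_nhds h) fun Y hY => by
        simp [cut, step_of_le hg (le_of_lt hY)]
    rw [hev.fderiv_eq]
    exact fderiv_const_apply _
  · have hO : IsOpen {Y : Config 2 | qfun Y < -g} := isOpen_lt continuous_qfun continuous_const
    have h' : qfun X < -g := by linarith
    have hev : cut g =ᶠ[𝓝 X] fun _ => (0 : ℂ) :=
      Filter.eventuallyEq_of_mem (hO.mem_nhds h') fun Y hY => by
        simp [cut, step_of_le_neg hg (le_of_lt hY)]
    rw [hev.fderiv_eq]
    exact fderiv_const_apply _

/-- **Derivative of the localised function**: the cut-off is flat wherever the state lives, so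
`∇(cut · Ψ) = cut · ∇Ψ` everywhere. -/
theorem fderiv_cut_mul {L : ℝ} (hL : 2 * L ^ 2 < 1) (Ψ : TrialState 2 L)
    (hE : energy hardSphere Ψ ≠ ⊤) (X : Config 2) :
    fderiv ℝ (fun Y => cut (1 - 2 * L ^ 2) Y * Ψ.ψ Y) X =
      cut (1 - 2 * L ^ 2) X • fderiv ℝ Ψ.ψ X := by
  have hg : 0 < 1 - 2 * L ^ 2 := by linarith
  have hc : DifferentiableAt ℝ (cut (1 - 2 * L ^ 2)) X :=
    ((contDiff_cut _).differentiable one_ne_zero) X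
  have hd : DifferentiableAt ℝ Ψ.ψ X := (Ψ.contDiff.differentiable one_ne_zero) X
  change fderiv ℝ (cut (1 - 2 * L ^ 2) * Ψ.ψ) X = _
  rw [fderiv_mul hc hd]
  by_cases hX : Ψ.ψ X = 0
  · rw [hX]
    ext1 w
    simp
  · rw [fderiv_cut_eq_zero hg (lt_abs_qfun_of_ne_zero Ψ hE hX)]
    ext1 w
    simp

theorem kineticDensity_cut_mul {L : ℝ} (hL : 2 * L ^ 2 < 1) (Ψ : TrialState 2 L)
    (hE : energy hardSphere Ψ ≠ ⊤) (X : Config 2) :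
    kineticDensity (fun Y => cut (1 - 2 * L ^ 2) Y * Ψ.ψ Y) X =
      wt (1 - 2 * L ^ 2) X * kineticDensity Ψ.ψ X := by
  simp only [kineticDensity, fderiv_cut_mul hL Ψ hE X, FunLike.coe_smul, Pi.smul_apply,
    nnnorm_smul, ENNReal.coe_mul, mul_pow, wt, Finset.mul_sum]

theorem nnnorm_cut_mul_sq (g : ℝ) (Ψ : Config 2 → ℂ) (X : Config 2) :
    (‖cut g X * Ψ X‖₊ : ℝ≥0∞) ^ 2 = wt g X * (‖Ψ X‖₊ : ℝ≥0∞) ^ 2 := by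
  rw [nnnorm_mul, ENNReal.coe_mul, mul_pow, wt]


/-! ### Masses and energies of the two halves -/

/-- abbreviation: the threshold `g = 1 - 2L²` -/
def thr (L : ℝ) : ℝ := 1 - 2 * L ^ 2

/-- energy density of a state -/
def edens (v : ℝ → ℝ≥0∞) {L : ℝ} (Ψ : TrialState N L) (X : Config N) : ℝ≥0∞ :=
  kineticDensity Ψ.ψ X + interaction v X * (‖Ψ.ψ X‖₊ : ℝ≥0∞) ^ 2

theorem energy_eq_lintegral_edens (v : ℝ → ℝ≥0∞) {L : ℝ} (Ψ : TrialState N L) :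
    energy v Ψ = ∫⁻ X, edens v Ψ X := rfl

theorem edens_reflectTS (v : ℝ → ℝ≥0∞) {L : ℝ} (Ψ : TrialState N L) (X : Config N) :
    edens v (reflectTS Ψ) X = edens v Ψ (reflC L X) := by
  unfold edens
  show kineticDensity (fun Y => Ψ.ψ (reflC L Y)) X + interaction v X * _ = _
  rw [kineticDensity_comp_reflC Ψ.contDiff, interaction_reflC]
  rfl

/-- mass of the `{q > 0}` half -/
def halfMass {L : ℝ} (Ψ : TrialState 2 L) : ℝ≥0∞ := ∫⁻ X, wt (thr L) X * (‖Ψ.ψ X‖₊ : ℝ≥0∞) ^ 2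

/-- energy of the `{q > 0}` half -/
def halfEnergy {L : ℝ} (Ψ : TrialState 2 L) : ℝ≥0∞ := ∫⁻ X, wt (thr L) X * edens hardSphere Ψ X

/-- pointwise splitting of any density vanishing on `{|q| < g}` -/
theorem split_pointwise {L : ℝ} (hL : 2 * L ^ 2 < 1) {F : Config 2 → ℝ≥0∞}
    (hF : ∀ X, |qfun X| < thr L → F X = 0) (X : Config 2) :
    wt (thr L) X * F X + wt (thr L) (reflC L X) * F X = F X := by
  have hg : 0 < thr L := by unfold thr; linarith
  by_cases hq : |qfun X| < thr L
  · simp [hF X hq]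
  · rw [← add_mul, wt_add_wt_reflC hg (not_lt.1 hq), one_mul]

theorem halfMass_add {L : ℝ} (hL : 2 * L ^ 2 < 1) (Ψ : TrialState 2 L)
    (hE : energy hardSphere Ψ ≠ ⊤) : halfMass Ψ + halfMass (reflectTS Ψ) = 1 := by
  have hF : ∀ X, |qfun X| < thr L → (‖Ψ.ψ X‖₊ : ℝ≥0∞) ^ 2 = 0 := by
    intro X hX
    have : Ψ.ψ X = 0 := by
      by_contra h
      exact absurd (lt_abs_qfun_of_ne_zero Ψ hE h) (not_lt.2 hX.le)
    simp [this]
  have h2 : halfMass (reflectTS Ψ) = ∫⁻ X, wt (thr L) (reflC L X) * (‖Ψ.ψ X‖₊ : ℝ≥0∞) ^ 2 := by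
    unfold halfMass
    rw [← lintegral_comp_reflC L (fun X => wt (thr L) (reflC L X) * (‖Ψ.ψ X‖₊ : ℝ≥0∞) ^ 2)]
    refine lintegral_congr fun X => ?_
    simp [reflC_reflC]
  have hm : Measurable fun X => wt (thr L) X * (‖Ψ.ψ X‖₊ : ℝ≥0∞) ^ 2 := by
    refine Measurable.mul ?_ ((Ψ.contDiff.continuous.measurable.nnnorm.coe_nnreal_ennreal).pow_const 2)
    exact ((contDiff_cut _).continuous.measurable.nnnorm.coe_nnreal_ennreal).pow_const 2
  rw [h2, halfMass, ← lintegral_add_left hm]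
  rw [← Ψ.norm_eq]
  exact lintegral_congr fun X => split_pointwise hL hF X

theorem halfEnergy_add {L : ℝ} (hL : 2 * L ^ 2 < 1) (Ψ : TrialState 2 L)
    (hE : energy hardSphere Ψ ≠ ⊤) :
    halfEnergy Ψ + halfEnergy (reflectTS Ψ) = energy hardSphere Ψ := by
  have hF : ∀ X, |qfun X| < thr L → edens hardSphere Ψ X = 0 := by
    intro X hX
    have h0 : Ψ.ψ X = 0 := by
      by_contra h
      exact absurd (lt_abs_qfun_of_ne_zero Ψ hE h) (not_lt.2 hX.le)
    simp [edens, h0, kineticDensity_eq_zero_of_abs_qfun_lt Ψ hE hX]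
  have h2 : halfEnergy (reflectTS Ψ) = ∫⁻ X, wt (thr L) (reflC L X) * edens hardSphere Ψ X := by
    unfold halfEnergy
    rw [← lintegral_comp_reflC L (fun X => wt (thr L) (reflC L X) * edens hardSphere Ψ X)]
    refine lintegral_congr fun X => ?_
    rw [reflC_reflC, edens_reflectTS]
  have hm : Measurable fun X => wt (thr L) X * edens hardSphere Ψ X := by
    refine Measurable.mul ?_ ?_
    · exact ((contDiff_cut _).continuous.measurable.nnnorm.coe_nnreal_ennreal).pow_const 2
    · exact measurable_energyDensity isRepulsiveFiniteRange_hardSphere.1 Ψ.contDiff.continuous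
  rw [h2, halfEnergy, ← lintegral_add_left hm, energy_eq_lintegral_edens]
  exact lintegral_congr fun X => split_pointwise hL hF X


/-! ### The normalised localised state and its energy -/

/-- **Localisation to the class `{q > 0}`** of a finite-energy two-body state with positive
`{q > 0}`-mass `m`: `m^{-1/2} · step(q) · Ψ`, an admissible trial state. -/
def locTS {L : ℝ} (Ψ : TrialState 2 L) (hm0 : halfMass Ψ ≠ 0) : TrialState 2 L where
  ψ X := ((Real.sqrt ((halfMass Ψ).toReal)⁻¹ : ℝ) : ℂ) * (cut (thr L) X * Ψ.ψ X)
  contDiff := contDiff_const.mul ((contDiff_cut _).mul Ψ.contDiff)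
  eq_zero X hX := by simp [Ψ.eq_zero X hX]
  symm σ X := by
    show _ = _
    simp only [cut, qfun_comp_perm, Ψ.symm]
  norm_eq := by
    have hm1 : halfMass Ψ ≤ 1 := by
      calc halfMass Ψ ≤ ∫⁻ X, 1 * (‖Ψ.ψ X‖₊ : ℝ≥0∞) ^ 2 :=
            lintegral_mono fun X => mul_le_mul' (wt_le_one _ _) le_rfl
        _ = 1 := by simp [Ψ.norm_eq]
    have hmt : halfMass Ψ ≠ ⊤ := ne_top_of_le_ne_top ENNReal.one_ne_top hm1
    have hpos : 0 < (halfMass Ψ).toReal := ENNReal.toReal_pos hm0 hmt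
    simp only [ennorm_real_mul_sq _ (Real.sqrt_nonneg _), nnnorm_cut_mul_sq]
    rw [lintegral_const_mul' _ _ ENNReal.ofReal_ne_top, Real.sq_sqrt (inv_nonneg.2 hpos.le),
      ENNReal.ofReal_inv_of_pos hpos, ENNReal.ofReal_toReal hmt]
    exact ENNReal.inv_mul_cancel hm0 hmt

theorem locTS_ψ {L : ℝ} (Ψ : TrialState 2 L) (hm0 : halfMass Ψ ≠ 0) (X : Config 2) :
    (locTS Ψ hm0).ψ X =
      ((Real.sqrt ((halfMass Ψ).toReal)⁻¹ : ℝ) : ℂ) * (cut (thr L) X * Ψ.ψ X) := rfl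

theorem halfMass_ne_top {L : ℝ} (Ψ : TrialState 2 L) : halfMass Ψ ≠ ⊤ := by
  have hm1 : halfMass Ψ ≤ 1 := by
    calc halfMass Ψ ≤ ∫⁻ X, 1 * (‖Ψ.ψ X‖₊ : ℝ≥0∞) ^ 2 :=
          lintegral_mono fun X => mul_le_mul' (wt_le_one _ _) le_rfl
      _ = 1 := by simp [Ψ.norm_eq]
  exact ne_top_of_le_ne_top ENNReal.one_ne_top hm1

/-- **Energy of the localised state**: `m⁻¹ ·` (energy of the `{q > 0}` half). -/
theorem energy_locTS {L : ℝ} (hL : 2 * L ^ 2 < 1) (Ψ : TrialState 2 L)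
    (hE : energy hardSphere Ψ ≠ ⊤) (hm0 : halfMass Ψ ≠ 0) :
    energy hardSphere (locTS Ψ hm0) = (halfMass Ψ)⁻¹ * halfEnergy Ψ := by
  have hmt := halfMass_ne_top Ψ
  have hpos : 0 < (halfMass Ψ).toReal := ENNReal.toReal_pos hm0 hmt
  have hc : ContDiff ℝ 1 fun X => cut (thr L) X * Ψ.ψ X := (contDiff_cut _).mul Ψ.contDiff
  unfold energy halfEnergy
  have hpt : ∀ X, kineticDensity (locTS Ψ hm0).ψ X +
      interaction hardSphere X * (‖(locTS Ψ hm0).ψ X‖₊ : ℝ≥0∞) ^ 2 =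
      ENNReal.ofReal ((Real.sqrt ((halfMass Ψ).toReal)⁻¹) ^ 2) *
        (wt (thr L) X * edens hardSphere Ψ X) := by
    intro X
    change kineticDensity (fun Y => ((Real.sqrt ((halfMass Ψ).toReal)⁻¹ : ℝ) : ℂ) *
        (cut (thr L) Y * Ψ.ψ Y)) X + interaction hardSphere X *
        (‖((Real.sqrt ((halfMass Ψ).toReal)⁻¹ : ℝ) : ℂ) * (cut (thr L) X * Ψ.ψ X)‖₊ : ℝ≥0∞) ^ 2 = _
    rw [kineticDensity_const_mul hc _ (Real.sqrt_nonneg _), ennorm_real_mul_sq _ (Real.sqrt_nonneg _),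
      nnnorm_cut_mul_sq]
    have hk : kineticDensity (fun Y => cut (thr L) Y * Ψ.ψ Y) X = wt (thr L) X * kineticDensity Ψ.ψ X :=
      kineticDensity_cut_mul hL Ψ hE X
    rw [hk, edens]
    ring
  simp_rw [hpt]
  rw [lintegral_const_mul' _ _ ENNReal.ofReal_ne_top, Real.sq_sqrt (inv_nonneg.2 hpos.le),
    ENNReal.ofReal_inv_of_pos hpos, ENNReal.ofReal_toReal hmt]

/-- **Variational lower bound for a half**: `m · E₀ ≤` energy of the `{q > 0}` half. -/
theorem halfMass_mul_le_halfEnergy {L : ℝ} (hL : 2 * L ^ 2 < 1) (Ψ : TrialState 2 L)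
    (hE : energy hardSphere Ψ ≠ ⊤) :
    halfMass Ψ * groundStateEnergy hardSphere 2 L ≤ halfEnergy Ψ := by
  by_cases hm0 : halfMass Ψ = 0
  · simp [hm0]
  · have hmt := halfMass_ne_top Ψ
    have h := groundStateEnergy_le_energy hardSphere (locTS Ψ hm0)
    rw [energy_locTS hL Ψ hE hm0] at h
    calc halfMass Ψ * groundStateEnergy hardSphere 2 L
        ≤ halfMass Ψ * ((halfMass Ψ)⁻¹ * halfEnergy Ψ) := mul_le_mul' le_rfl h
      _ = halfEnergy Ψ := by rw [← mul_assoc, ENNReal.mul_inv_cancel hm0 hmt, one_mul]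

/-- **Support of the localised state**: it lives where `q > g`. -/
theorem thr_lt_qfun_of_locTS_ne_zero {L : ℝ} (hL : 2 * L ^ 2 < 1) (Ψ : TrialState 2 L)
    (hE : energy hardSphere Ψ ≠ ⊤) (hm0 : halfMass Ψ ≠ 0) {X : Config 2}
    (hX : (locTS Ψ hm0).ψ X ≠ 0) : thr L < qfun X := by
  have hg : 0 < thr L := by unfold thr; linarith
  rw [locTS_ψ] at hX
  have h1 : cut (thr L) X ≠ 0 := fun h => hX (by simp [h])
  have h2 : Ψ.ψ X ≠ 0 := fun h => hX (by simp [h])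
  have hq : thr L < |qfun X| := lt_abs_qfun_of_ne_zero Ψ hE h2
  rcases lt_abs.1 hq with h | h
  · exact h
  · exfalso
    apply h1
    simp [cut, step_of_le_neg hg (by linarith : qfun X ≤ -thr L)]

/-! ### Finite ground-state energy: a witness near opposite corners -/

/-- the interaction of a single particle vanishes -/
theorem interaction_one (v : ℝ → ℝ≥0∞) (Y : Config 1) : interaction v Y = 0 := by
  unfold interaction
  refine Finset.sum_eq_zero fun i _ => Finset.sum_eq_zero fun j hj => ?_
  exfalso
  have : i < j := (Finset.mem_filter.1 hj).2
  exact absurd this (by omega)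

theorem energy_one_ne_top (v : ℝ → ℝ≥0∞) {L : ℝ} (Ψ : TrialState 1 L) : energy v Ψ ≠ ⊤ := by
  unfold energy
  simp only [interaction_one, zero_mul, add_zero]
  exact (TrialState.lintegral_kineticDensity_lt_top Ψ).ne

/-- **`E₀ < ⊤` for two unit hard spheres when `3L² > 1`**: a symmetrised product of one-particle
states near the corners `0` and `(L,L,L)` has finite energy. -/
theorem groundStateEnergy_two_ne_top {L : ℝ} (hL0 : 0 < L) (hL : 1 < 3 * L ^ 2) :
    groundStateEnergy hardSphere 2 L ≠ ⊤ := by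
  -- a number `t` with `1/3 < t² < L²`, `0 < t < L`
  set t : ℝ := Real.sqrt ((1 / 3 + L ^ 2) / 2) with ht
  have ht2 : t ^ 2 = (1 / 3 + L ^ 2) / 2 := Real.sq_sqrt (by positivity)
  have ht0 : 0 < t := Real.sqrt_pos.2 (by positivity)
  have htL : t < L := by nlinarith
  have ht3 : 1 < 3 * t ^ 2 := by nlinarith
  set ε : ℝ := (L - t) / 2 with hε
  have hε0 : 0 < ε := by linarith
  have hεL : ε ≤ L := by linarith
  -- one-particle states in the small boxes
  obtain ⟨Ψ₀⟩ := TrialState.nonempty (N := 1) one_pos hε0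
  let a : Space := WithLp.toLp 2 fun _ : Fin 3 => L - ε
  let S₁ : Set Space := box ε
  let S₂ : Set Space := {x | x - a ∈ box ε}
  have hS₂L : S₂ ⊆ box L := by
    intro x hx k
    have hk := hx k
    simp only [a, PiLp.sub_apply, Set.mem_Ioo] at hk
    constructor <;> linarith [hk.1, hk.2]
  let Ψ₁ : TrialState 1 L := Ψ₀.enlarge hεL
  let Ψ₂ : TrialState 1 L := ((Ψ₀.toSupported.translate a).mono hS₂L).toTrialState
  have hS₁ : ∀ Y : Config 1, (∃ i, Y i ∉ S₁) → Ψ₁.ψ Y = 0 := by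
    rintro Y ⟨i, hi⟩
    exact Ψ₀.eq_zero Y (fun h => hi (h i))
  have hS₂ : ∀ Y : Config 1, (∃ i, Y i ∉ S₂) → Ψ₂.ψ Y = 0 := by
    rintro Y ⟨i, hi⟩
    exact (Ψ₀.toSupported.translate a).eq_zero Y ⟨i, hi⟩
  have hdisj : Disjoint (closure S₁) (closure S₂) := by
    have h1 : closure S₁ ⊆ {x : Space | x 0 ≤ ε} :=
      closure_minimal (fun x hx => (hx 0).2.le) (isClosed_le (by fun_prop) continuous_const)
    have h2 : closure S₂ ⊆ {x : Space | L - ε ≤ x 0} := by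
      refine closure_minimal (fun x hx => ?_) (isClosed_le continuous_const (by fun_prop))
      have := (hx 0).1
      simp only [a, PiLp.sub_apply] at this
      show L - ε ≤ x 0
      linarith
    refine Set.disjoint_of_subset h1 h2 (Set.disjoint_left.2 fun x hx hx' => ?_)
    simp only [Set.mem_setOf_eq] at hx hx'
    linarith
  have hsep : ∀ x ∈ S₁, ∀ y ∈ S₂, (1 : ℝ) < dist x y := by
    intro x hx y hy
    rw [EuclideanSpace.dist_eq, Real.lt_sqrt (by norm_num)]
    have hk : ∀ k : Fin 3, t ^ 2 < dist (x k) (y k) ^ 2 := by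
      intro k
      have h1 := (hx k).2
      have h2 := (hy k).1
      simp only [a, PiLp.sub_apply] at h2
      rw [Real.dist_eq, sq_abs]
      nlinarith
    calc (1 : ℝ) ^ 2 < 3 * t ^ 2 := by linarith
      _ = ∑ _k : Fin 3, t ^ 2 := by simp [Finset.sum_const]
      _ ≤ ∑ k, dist (x k) (y k) ^ 2 := Finset.sum_le_sum fun k _ => (hk k).le
  have hvR : ∀ r, (1 : ℝ) < r → hardSphere r = 0 := fun r hr => by simp [hardSphere, not_le.2 hr]
  have hcomb := TrialState.energy_combine Ψ₁ Ψ₂ hS₁ hS₂ hdisj isRepulsiveFiniteRange_hardSphere.1 hvR hsep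
  have hfin : energy hardSphere (Ψ₁.combine Ψ₂ hS₁ hS₂ hdisj) ≠ ⊤ := by
    rw [hcomb]
    exact ENNReal.add_ne_top.2 ⟨energy_one_ne_top _ Ψ₁, energy_one_ne_top _ Ψ₂⟩
  have hle : groundStateEnergy hardSphere 2 L ≤ energy hardSphere (Ψ₁.combine Ψ₂ hS₁ hS₂ hdisj) :=
    groundStateEnergy_le_energy hardSphere _
  exact ne_top_of_le_ne_top hfin hle


/-! ### Assembly: no rigidity for two unit hard spheres in a box with `1/3 < L² < 1/2` -/

/-- **Core step**: a near-minimiser whose `{q > 0}` half carries mass `≥ 1/2` yields two DISJOINTLY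
supported near-minimisers (its localisation and the reflection of that) at twice the slack. -/
theorem exists_disjoint_pair {L : ℝ} (hL : 2 * L ^ 2 < 1) {ε : ℝ≥0∞} (Φ : TrialState 2 L)
    (hEΦ : energy hardSphere Φ ≤ groundStateEnergy hardSphere 2 L + ε)
    (hE0 : groundStateEnergy hardSphere 2 L ≠ ⊤) (hεt : ε ≠ ⊤) (hm : 2⁻¹ ≤ halfMass Φ) :
    ∃ Ψ₁ Ψ₂ : TrialState 2 L, (∀ X, Ψ₁.ψ X = 0 ∨ Ψ₂.ψ X = 0) ∧
      energy hardSphere Ψ₁ ≤ groundStateEnergy hardSphere 2 L + 2 * ε ∧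
      energy hardSphere Ψ₂ ≤ groundStateEnergy hardSphere 2 L + 2 * ε := by
  set E₀ := groundStateEnergy hardSphere 2 L with hE₀
  have hg : 0 < thr L := by unfold thr; linarith
  have hΦt : energy hardSphere Φ ≠ ⊤ :=
    ne_top_of_le_ne_top (ENNReal.add_ne_top.2 ⟨hE0, hεt⟩) hEΦ
  have hm0 : halfMass Φ ≠ 0 := by
    intro h
    rw [h] at hm
    exact absurd hm (by norm_num)
  have hmt : halfMass Φ ≠ ⊤ := halfMass_ne_top Φ
  set Ψ₁ := locTS Φ hm0 with hΨ₁
  -- energy of the localisation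
  have hE1 : energy hardSphere Ψ₁ ≤ E₀ + 2 * ε := by
    have hsumM := halfMass_add hL Φ hΦt
    have hsumE := halfEnergy_add hL Φ hΦt
    have hΦ't : energy hardSphere (reflectTS Φ) ≠ ⊤ := by rwa [energy_reflectTS]
    have hlow : halfMass (reflectTS Φ) * E₀ ≤ halfEnergy (reflectTS Φ) :=
      halfMass_mul_le_halfEnergy hL (reflectTS Φ) hΦ't
    have hm't : halfMass (reflectTS Φ) * E₀ ≠ ⊤ := ENNReal.mul_ne_top (halfMass_ne_top _) hE0
    -- halfEnergy Φ ≤ m E₀ + ε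
    have hkey : halfEnergy Φ ≤ halfMass Φ * E₀ + ε := by
      have h1 : halfEnergy Φ + halfMass (reflectTS Φ) * E₀ ≤ halfMass Φ * E₀ + ε +
          halfMass (reflectTS Φ) * E₀ := by
        calc halfEnergy Φ + halfMass (reflectTS Φ) * E₀
            ≤ halfEnergy Φ + halfEnergy (reflectTS Φ) := add_le_add le_rfl hlow
          _ = energy hardSphere Φ := hsumE
          _ ≤ E₀ + ε := hEΦ
          _ = (halfMass Φ + halfMass (reflectTS Φ)) * E₀ + ε := by rw [hsumM, one_mul]
          _ = halfMass Φ * E₀ + ε + halfMass (reflectTS Φ) * E₀ := by rw [add_mul]; ring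
      exact (ENNReal.add_le_add_iff_right hm't).1 h1
    calc energy hardSphere Ψ₁ = (halfMass Φ)⁻¹ * halfEnergy Φ := energy_locTS hL Φ hΦt hm0
      _ ≤ (halfMass Φ)⁻¹ * (halfMass Φ * E₀ + ε) := mul_le_mul' le_rfl hkey
      _ = E₀ + (halfMass Φ)⁻¹ * ε := by
          rw [mul_add, ← mul_assoc, ENNReal.inv_mul_cancel hm0 hmt, one_mul]
      _ ≤ E₀ + 2 * ε := by
          gcongr
          calc (halfMass Φ)⁻¹ ≤ (2⁻¹ : ℝ≥0∞)⁻¹ := ENNReal.inv_le_inv.2 hm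
            _ = 2 := inv_inv 2
  refine ⟨Ψ₁, reflectTS Ψ₁, fun X => ?_, hE1, by rw [energy_reflectTS]; exact hE1⟩
  by_contra hX
  push Not at hX
  have h1 : thr L < qfun X := thr_lt_qfun_of_locTS_ne_zero hL Φ hΦt hm0 hX.1
  have h2 : thr L < qfun (reflC L X) := thr_lt_qfun_of_locTS_ne_zero hL Φ hΦt hm0 hX.2
  rw [qfun_reflC] at h2
  linarith

/-- **Two unit hard spheres in a box with `1/3 < L² < 1/2` have NO rigid ground state**: `E₀ < ⊤`,
yet at every slack there are two disjointly supported near-minimisers (localise any near-minimiser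
to the heavier of the two classes `{q > 0}`, `{q < 0}` of the disconnected free region, and reflect it
in the plane `x₀ = L/2`). -/
theorem not_rigidAt_two_hardSpheres {L : ℝ} (hL0 : 0 < L) (h3 : 1 < 3 * L ^ 2)
    (h2 : 2 * L ^ 2 < 1) : ¬ RigidAt hardSphere 2 L := by
  apply not_rigidAt_of_disjoint
  intro δ hδ
  have hE0 := groundStateEnergy_two_ne_top hL0 h3
  -- slack `ε = min δ 1 / 2`
  set ε : ℝ≥0∞ := min δ 1 / 2 with hε
  have hmin0 : min δ 1 ≠ 0 := (lt_min hδ one_pos).ne'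
  have hmint : min δ 1 ≠ ⊤ := ne_top_of_le_ne_top ENNReal.one_ne_top (min_le_right _ _)
  have hε0 : 0 < ε := ENNReal.div_pos hmin0 (by norm_num)
  have hεt : ε ≠ ⊤ := ENNReal.div_ne_top hmint (by norm_num)
  have h2ε : 2 * ε ≤ δ := by
    rw [hε, ENNReal.mul_div_cancel (by norm_num) (by norm_num)]
    exact min_le_left _ _
  -- a near-minimiser at slack `ε`
  obtain ⟨Φ, hΦ⟩ : ∃ Φ : TrialState 2 L,
      energy hardSphere Φ < groundStateEnergy hardSphere 2 L + ε :=
    iInf_lt_iff.1 (ENNReal.lt_add_right hE0 hε0.ne')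
  have hΦt : energy hardSphere Φ ≠ ⊤ :=
    ne_top_of_lt (hΦ.trans_le le_top)
  have hsum := halfMass_add h2 Φ hΦt
  by_cases hm : 2⁻¹ ≤ halfMass Φ
  · obtain ⟨Ψ₁, Ψ₂, hd, e1, e2⟩ := exists_disjoint_pair h2 Φ hΦ.le hE0 hεt hm
    exact ⟨Ψ₁, Ψ₂, hd, e1.trans (add_le_add le_rfl h2ε), e2.trans (add_le_add le_rfl h2ε)⟩
  · have hm' : 2⁻¹ ≤ halfMass (reflectTS Φ) := by
      by_contra h
      push Not at hm h
      have : halfMass Φ + halfMass (reflectTS Φ) < 2⁻¹ + 2⁻¹ := ENNReal.add_lt_add hm h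
      rw [hsum, ENNReal.inv_two_add_inv_two] at this
      exact lt_irrefl _ this
    have hΦ' : energy hardSphere (reflectTS Φ) ≤ groundStateEnergy hardSphere 2 L + ε := by
      rw [energy_reflectTS]
      exact hΦ.le
    obtain ⟨Ψ₁, Ψ₂, hd, e1, e2⟩ := exists_disjoint_pair h2 (reflectTS Φ) hΦ' hE0 hεt hm'
    exact ⟨Ψ₁, Ψ₂, hd, e1.trans (add_le_add le_rfl h2ε), e2.trans (add_le_add le_rfl h2ε)⟩

/-- The window is nonempty: `L = 13/20` has `3L² = 1.2675 > 1` and `2L² = 0.845 < 1`. -/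
theorem not_rigidAt_two_hardSpheres_example : ¬ RigidAt hardSphere 2 (13 / 20) :=
  not_rigidAt_two_hardSpheres (by norm_num) (by norm_num) (by norm_num)


/-- **The finite-energy strengthening of `GroundStateRigidity` is false**: it is NOT true that for every
admissible `v`, every `N ≥ 1` and every box `L > 0` with `E₀(N, L) < ⊤` near-minimisers are rigid
(witness: unit hard spheres, `N = 2`, `L = 13/20`). [folklore] -/
theorem groundStateRigidity_finiteEnergy_strengthening_false :
    ¬ (∀ v : ℝ → ℝ≥0∞, IsRepulsiveFiniteRange v → ∀ N : ℕ, 1 ≤ N → ∀ L : ℝ, 0 < L →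
        groundStateEnergy v N L ≠ ⊤ → RigidAt v N L) := by
  intro h
  exact not_rigidAt_two_hardSpheres_example
    (h hardSphere isRepulsiveFiniteRange_hardSphere 2 (by norm_num) (13 / 20) (by norm_num)
      (groundStateEnergy_two_ne_top (by norm_num) (by norm_num)))

/-- **In the vocabulary of line `Sketch`**: once `stub_compactness` (hypothesis `hC`, verbatim) and
`stub_rigidityOfUnique` (hypothesis `hR`, verbatim) are proved, the tree knows an admissible `v` and a
finite-energy box with a DEGENERATE ground state: `¬ HasUniqueGroundState hardSphere 2 (13/20)`.
(So `HasUniqueGroundState` for unbounded admissible `v` is genuinely density-dependent.) [folklore] -/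
theorem not_hasUniqueGroundState_two_of_stubs
    (hC : ∀ (N : ℕ) (L : ℝ) (v : ℝ → ℝ≥0∞) (E : ℝ≥0∞) (Φ : ℕ → TrialState N L), E ≠ ⊤ →
      (∀ n, energy v (Φ n) ≤ E) →
      ∃ (Ψ : Config N → ℂ) (φ : ℕ → ℕ), StrictMono φ ∧ Measurable Ψ ∧
        (∀ X, X ∉ boxN N L → Ψ X = 0) ∧
        (∀ (σ : Equiv.Perm (Fin N)) (X : Config N), Ψ (X ∘ σ) = Ψ X) ∧
        TendstoL2 (fun n => Φ (φ n)) Ψ)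
    (hR : (∀ (N : ℕ) (L : ℝ) (v : ℝ → ℝ≥0∞) (E : ℝ≥0∞) (Φ : ℕ → TrialState N L), E ≠ ⊤ →
      (∀ n, energy v (Φ n) ≤ E) →
      ∃ (Ψ : Config N → ℂ) (φ : ℕ → ℕ), StrictMono φ ∧ Measurable Ψ ∧
        (∀ X, X ∉ boxN N L → Ψ X = 0) ∧
        (∀ (σ : Equiv.Perm (Fin N)) (X : Config N), Ψ (X ∘ σ) = Ψ X) ∧
        TendstoL2 (fun n => Φ (φ n)) Ψ) →
      ∀ (v : ℝ → ℝ≥0∞) (N : ℕ) (L : ℝ), HasUniqueGroundState v N L →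
        ∀ η : ℝ, 0 < η → ∃ δ : ℝ≥0∞, 0 < δ ∧ ∀ Ψ Φ : TrialState N L,
          energy v Ψ ≤ groundStateEnergy v N L + δ → energy v Φ ≤ groundStateEnergy v N L + δ →
          ∃ c : ℂ, ‖c‖ = 1 ∧ ∫⁻ X, (‖Ψ.ψ X - c * Φ.ψ X‖₊ : ℝ≥0∞) ^ 2 ≤ ENNReal.ofReal η) :
    ¬ HasUniqueGroundState hardSphere 2 (13 / 20) := fun hU =>
  not_rigidAt_two_hardSpheres_example (hR hC hardSphere 2 (13 / 20) hU)

end SmallModel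

/-! ## 5. Line `Sketch` (lead skeleton v1, stubs `stub_compactness`, `stub_rigidityOfUnique`,
`stub_fkJensen`, `stub_stabilityOfJensen`, `stub_uniqueOfStability`, `stub_uniqueUnbounded`)

Attacked each stub by degenerate instances and junk values; none breaks.  Notes for the lead:

* `stub_compactness` (every `v`, every `N`, `L`): `N = 0` is fine (`Config 0` is a point, `volume` there is
  the Dirac mass — `Measure.pi_of_empty` —, `TrialState 0 L` = unit constants, the circle is compact);
  `L ≤ 0`, `N ≥ 1`: `TrialState` empty, the sequence hypothesis is not inhabitable, vacuous.  True (Rellich).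
* `stub_rigidityOfUnique`: true for every `v` by the stated contradiction argument; `HasUniqueGroundState.1`
  supplies `E₀ < ⊤`, needed so that `1/(n+1)`-near-minimisers have energies bounded by `E₀ + 1 < ⊤`.
* `stub_fkJensen`: no `1 ≤ N` hypothesis, but `N = 0` is an equality (`fkWeight ≡ 1`, `fkReal v L 1 f = f`);
  `f ≡ 0` gives `0 ≤ 0` (`0/0 = 0`).  For `N ≥ 1` it is Jensen on the spectral measure of `f` — true once
  `fkReal = e^{-H}` on the `C¹` Dirichlet core (bounded `v`).  No junk found.
* `stub_stabilityOfJensen`: the conclusion quantifies over ALL real `C¹` Dirichlet `f`, not only symmetric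
  ones, while `E₀` is the Bose infimum — consistent because for bounded `v` the absolute ground state is
  symmetric (PF), so `E₀^{Bose} = E₀^{abs}` and `κ` may be the absolute gap.  For bounded `v` both `toReal`s
  are of finite quantities (no junk).  True.
* `stub_uniqueOfStability`: the `toReal` of a possibly infinite `∫⁻ interaction·f²` inside a HYPOTHESIS only
  strengthens the hypothesis; `e` is not required Dirichlet/symmetric but only `∫_Λ e·f` enters, and the
  ground state obtained is `|Ψ| = e·1_Λ` a.e.; `N = 0` holds genuinely.  True.
* `stub_uniqueUnbounded` (open kernel): includes `HasUniqueGroundState.1` = EXISTENCE of a nonnegative ground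
  state, hence `E₀ < ⊤` eventually — true at `ρ < ρ₀(v)` but it must be proved (cf. §1, §3: at `ρ = 64` unit
  hard spheres have `E₀ = ⊤` for all `N ≥ 64`).  §4 shows uniqueness genuinely FAILS for admissible `v` at some
  finite-energy `(N, L)`, so the proof must use low density and cannot be a soft Perron–Frobenius argument.
* Joint sufficiency `GroundStateRigidity_of`: kernel-checked in the skeleton; no gap.
-/

end Summit.AtomisticToContinuum.BoseEinsteinCondensation.Cruxes.GroundStateRigidity.Disproof

end
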